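import Literature.MathematicalPhysics.QuantumLattice.GrassmannFlowIteration
import Literature.MathematicalPhysics.QuantumLattice.GrassmannKernelExpansion
import Literature.MathematicalPhysics.QuantumLattice.GrassmannPairLaplacians
import Literature.MathematicalPhysics.QuantumLattice.GrassmannGaussianQuadraticInsertion
import HarnessLib

/-!
# The two-point function from the Wilsonian effective action: `⟨ψ_X ψ_Y e^{-V}⟩/Z = A(X,Y) + Σ A(X,Y′) A(Y,X′) ∂_{X′}∂_{Y′}W |₀`

Topic `MathematicalPhysics/QuantumLattice`; cell gate-hubbard-kl, R0-SCOPE-4 P6 (the Schwinger function in terms of the effective potential,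
Benfatto–Giuliani–Mastropietro 2006, §2.9 (2.90)–(2.92): the two-point Schwinger function is the free propagator dressed by the quadratic
kernel of the effective potential; Salmhofer 1999, §4.3 (4.88)–(4.91)).  For a finite Grassmann algebra, an arbitrary covariance `C` with pair
function `A(X,Y) = ½(C(Y,X) - C(X,Y))`, and an even interaction `V` without constant part whose normalised partition function `Z = ∫dμ_C e^{-V}`
is a unit, the effective action `W = effAction C V` (`Z⁻¹∫dμ_C(χ)e^{-V(χ+ψ)} = e^{-W(ψ)}`) gives

`∫ dμ_C ψ_X ψ_Y e^{-V} = Z · (A(X,Y) + Σ_{X′,Y′} A(X,Y′) A(Y,X′) · constPart(∂_{X′} ∂_{Y′} W))`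

(`gaussExpect_gen_mul_gen_mul_grassmannExp_neg`): two integrations by parts (`gaussExpect_gen_mul`), commutation of the derivatives with
`μ_C ⋆` (`grassmannDeriv_gaussConv`), `μ_C ⋆ e^{-V} = Z e^{-W}` (`effBoltzmann_eq_smul_grassmannExp`), and the chain rule for the even
nilpotent `-W` (the odd derivative `∂W` has no constant part).  Corollary `norm_twoPoint_le`: if `|A| ≤ a`, the row/column sums of `|A|` are
`≤ α`, and `Σ_{X′} |constPart(∂_{X′}∂_{Y′}W)| ≤ w` for every `Y′`, then `|⟨ψ_Xψ_Y e^{-V}⟩/Z| ≤ a (1 + α w)`.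

Everything is proved; no definitions, no named facts.

## Sources

G. Benfatto, A. Giuliani, V. Mastropietro, Ann. Henri Poincaré 7 (2006) 809–898, §2.9 (2.90)–(2.92) (`BenfattoGiulianiMastropietro2006`);
M. Salmhofer, *Renormalization* (1999), §4.3 (4.88)–(4.91) (`Salmhofer1999`).
-/

noncomputable section

namespace Literature.MathematicalPhysics.QuantumLattice

open GrassmannAlgebra Finset

variable {R : Type*} [CommRing R] [Algebra ℚ R] {Γ : Type*} [Fintype Γ] [DecidableEq Γ]

omit [Algebra ℚ R] [DecidableEq Γ] in
/-- The constant part of the derivative of an even element vanishes. [cite: Salmhofer1999, §4.3 (4.90)] -/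
theorem constPart_grassmannDeriv_of_mem_evenPart (X : Γ) {a : GrassmannAlgebra R Γ} (ha : a ∈ evenPart R Γ) :
    constPart R (grassmannDeriv R X a) = 0 := by
  have h := grassmannDeriv_mem_evenOdd (R := R) X (i := 0) ha
  rw [zero_add] at h
  exact constPart_eq_zero_of_mem_evenOdd_one R h

omit [DecidableEq Γ] in
/-- **The second derivative of `e^{-W}` at zero** for an even `W` without constant part:
`constPart(∂_{X′} ∂_{Y′} e^{-W}) = -constPart(∂_{X′} ∂_{Y′} W)`. [cite: Salmhofer1999, §4.3 (4.90)] -/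
theorem constPart_grassmannDeriv_grassmannDeriv_grassmannExp_neg (X' Y' : Γ) {W : GrassmannAlgebra R Γ} (hW : W ∈ evenPart R Γ)
    (hW0 : constPart R W = 0) :
    constPart R (grassmannDeriv R X' (grassmannDeriv R Y' (grassmannExp (-W)))) =
      -constPart R (grassmannDeriv R X' (grassmannDeriv R Y' W)) := by
  have hWn : (-W) ∈ evenOdd R 0 := Submodule.neg_mem _ hW
  have hnil : IsNilpotent (-W) := isNilpotent_of_constPart_eq_zero R (by rw [map_neg, hW0, neg_zero])
  have hexp : grassmannExp (-W) ∈ evenOdd R 0 := grassmannExp_mem_evenOdd_zero R hWn hnil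
  rw [grassmannDeriv_grassmannExp_of_mem_evenOdd_zero R Y' hWn hnil, grassmannDeriv_mul_of_mem_evenOdd_zero R X' hexp, map_add, map_mul,
    map_mul, constPart_grassmannDeriv_of_mem_evenPart Y' hWn, mul_zero, zero_add]
  have h1 : constPart R (grassmannExp (-W)) = 1 := by
    rw [grassmannExp, IsNilpotent.map_exp hnil, map_neg, hW0, neg_zero, IsNilpotent.exp_zero]
  rw [h1, one_mul, map_neg, map_neg, map_neg]

section Main

variable {𝕜 : Type*} [RCLike 𝕜]

/-- **The two-point function from the effective action** (BGM (2.90)–(2.92), Salmhofer (4.88)–(4.91)): for `V` even without constant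
part with `Z = ∫dμ_C e^{-V}` a unit,
`∫dμ_C ψ_X ψ_Y e^{-V} = Z (A(X,Y) + Σ_{Y′,X′} A(X,Y′) A(Y,X′) constPart(∂_{X′}∂_{Y′} W))`, `A(X,Y) = ½(C(Y,X)-C(X,Y))`, `W = effAction C V`.
[cite: BenfattoGiulianiMastropietro2006, §2.9 (2.90)-(2.92)] -/
theorem gaussExpect_gen_mul_gen_mul_grassmannExp_neg (C : Matrix Γ Γ 𝕜) {V : GrassmannAlgebra 𝕜 Γ} (hV : V ∈ evenPart 𝕜 Γ)
    (hV0 : constPart 𝕜 V = 0) (hZ : IsUnit (effPartitionFn 𝕜 C V)) (X Y : Γ) :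
    gaussExpect 𝕜 C (gen 𝕜 X * gen 𝕜 Y * grassmannExp (-V)) =
      effPartitionFn 𝕜 C V * ((((1 / 2 : ℚ) • (1 : 𝕜)) * (C Y X - C X Y)) +
        ∑ Y', ∑ X', (((1 / 2 : ℚ) • (1 : 𝕜)) * (C Y' X - C X Y')) * ((((1 / 2 : ℚ) • (1 : 𝕜)) * (C X' Y - C Y X')) *
          constPart 𝕜 (grassmannDeriv 𝕜 X' (grassmannDeriv 𝕜 Y' (effAction 𝕜 C V))))) := by
  have hW : effAction 𝕜 C V ∈ evenPart 𝕜 Γ := effAction_mem_evenPart C hV hV0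
  have hW0 : constPart 𝕜 (effAction 𝕜 C V) = 0 := constPart_effAction 𝕜 C V hZ
  -- second derivatives of `e^{-V}` under the Gaussian expectation
  have hsecond : ∀ X' Y' : Γ, gaussExpect 𝕜 C (grassmannDeriv 𝕜 X' (grassmannDeriv 𝕜 Y' (grassmannExp (-V)))) =
      -(effPartitionFn 𝕜 C V * constPart 𝕜 (grassmannDeriv 𝕜 X' (grassmannDeriv 𝕜 Y' (effAction 𝕜 C V)))) := by
    intro X' Y'
    rw [gaussExpect_apply, ← grassmannDeriv_gaussConv, ← grassmannDeriv_gaussConv, ← effBoltzmann_def,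
      effBoltzmann_eq_smul_grassmannExp 𝕜 C V hZ, map_smul, map_smul, map_smul, smul_eq_mul,
      constPart_grassmannDeriv_grassmannDeriv_grassmannExp_neg X' Y' hW hW0, mul_neg]
  -- two integrations by parts
  rw [mul_assoc, gaussExpect_gen_mul]
  have hinner : ∀ Y' : Γ, gaussExpect 𝕜 C (grassmannDeriv 𝕜 Y' (gen 𝕜 Y * grassmannExp (-V))) =
      (if Y' = Y then effPartitionFn 𝕜 C V else 0) -
        ∑ X', (((1 / 2 : ℚ) • (1 : 𝕜)) * (C X' Y - C Y X')) *
          gaussExpect 𝕜 C (grassmannDeriv 𝕜 X' (grassmannDeriv 𝕜 Y' (grassmannExp (-V)))) := by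
    intro Y'
    rw [grassmannDeriv_gen_mul, map_sub, gaussExpect_gen_mul]
    congr 1
    split_ifs with h
    · rw [← effPartitionFn_eq_gaussExpect]
    · rw [map_zero]
  have hterm' : ∀ Y' : Γ, (((1 / 2 : ℚ) • (1 : 𝕜)) * (C Y' X - C X Y')) * gaussExpect 𝕜 C (grassmannDeriv 𝕜 Y' (gen 𝕜 Y * grassmannExp (-V))) =
      (((1 / 2 : ℚ) • (1 : 𝕜)) * (C Y' X - C X Y')) * (if Y' = Y then effPartitionFn 𝕜 C V else 0) +
        ∑ X', (((1 / 2 : ℚ) • (1 : 𝕜)) * (C Y' X - C X Y')) * ((((1 / 2 : ℚ) • (1 : 𝕜)) * (C X' Y - C Y X')) *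
          (effPartitionFn 𝕜 C V * constPart 𝕜 (grassmannDeriv 𝕜 X' (grassmannDeriv 𝕜 Y' (effAction 𝕜 C V))))) := by
    intro Y'
    rw [hinner Y', mul_sub, Finset.mul_sum, sub_eq_add_neg, ← Finset.sum_neg_distrib]
    congr 1
    refine Finset.sum_congr rfl fun X' _ => ?_
    rw [hsecond X' Y']
    ring
  rw [Finset.sum_congr rfl fun Y' _ => hterm' Y', Finset.sum_add_distrib]
  simp_rw [mul_ite, mul_zero]
  rw [Finset.sum_ite_eq' Finset.univ Y, if_pos (Finset.mem_univ _), mul_add, Finset.mul_sum]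
  congr 1
  · ring
  · refine Finset.sum_congr rfl fun Y' _ => ?_
    rw [Finset.mul_sum]
    refine Finset.sum_congr rfl fun X' _ => ?_
    ring

end Main

section Bound

variable {Γ' : Type*} [Fintype Γ'] [DecidableEq Γ']

/-- **The two-point function is bounded by the dressed propagator** (complex coefficients): with `‖A(X,Y)‖ ≤ a` for all labels,
`Σ_{Y′} ‖A(X,Y′)‖ ≤ α`, and `Σ_{X′} ‖constPart(∂_{X′}∂_{Y′}W)‖ ≤ w` for every `Y′`,
`‖∫dμ_C ψ_X ψ_Y e^{-V}‖ ≤ ‖Z‖ · a · (1 + α w)`. [cite: BenfattoGiulianiMastropietro2006, §2.9 (2.92)] -/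
theorem norm_gaussExpect_twoPoint_le (C : Matrix Γ' Γ' ℂ) {V : GrassmannAlgebra ℂ Γ'} (hV : V ∈ evenPart ℂ Γ')
    (hV0 : constPart ℂ V = 0) (hZ : IsUnit (effPartitionFn ℂ C V)) (X Y : Γ') {a α w : ℝ} (ha : 0 ≤ a) (hw : 0 ≤ w)
    (hA : ∀ X Y : Γ', ‖((1 / 2 : ℚ) • (1 : ℂ)) * (C Y X - C X Y)‖ ≤ a)
    (hrow : ∑ Y', ‖((1 / 2 : ℚ) • (1 : ℂ)) * (C Y' X - C X Y')‖ ≤ α)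
    (hW : ∀ Y' : Γ', ∑ X', ‖constPart ℂ (grassmannDeriv ℂ X' (grassmannDeriv ℂ Y' (effAction ℂ C V)))‖ ≤ w) :
    ‖gaussExpect ℂ C (gen ℂ X * gen ℂ Y * grassmannExp (-V))‖ ≤ ‖effPartitionFn ℂ C V‖ * (a * (1 + α * w)) := by
  rw [gaussExpect_gen_mul_gen_mul_grassmannExp_neg C hV hV0 hZ X Y, norm_mul]
  refine mul_le_mul_of_nonneg_left ?_ (norm_nonneg _)
  refine (norm_add_le _ _).trans ?_
  rw [mul_add, mul_one]
  refine add_le_add (hA X Y) ?_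
  set c : Γ' → Γ' → ℂ := fun X' Y' => constPart ℂ (grassmannDeriv ℂ X' (grassmannDeriv ℂ Y' (effAction ℂ C V))) with hc
  set A : Γ' → Γ' → ℂ := fun X Y => ((1 / 2 : ℚ) • (1 : ℂ)) * (C Y X - C X Y) with hAdef
  have hterm : ∀ Y' X' : Γ', ‖A X Y' * (A Y X' * c X' Y')‖ ≤ ‖A X Y'‖ * (a * ‖c X' Y'‖) := by
    intro Y' X'
    calc ‖A X Y' * (A Y X' * c X' Y')‖ ≤ ‖A X Y'‖ * ‖A Y X' * c X' Y'‖ := norm_mul_le _ _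
      _ ≤ ‖A X Y'‖ * (‖A Y X'‖ * ‖c X' Y'‖) := mul_le_mul_of_nonneg_left (norm_mul_le _ _) (norm_nonneg _)
      _ ≤ ‖A X Y'‖ * (a * ‖c X' Y'‖) := mul_le_mul_of_nonneg_left (mul_le_mul_of_nonneg_right (hA Y X') (norm_nonneg _)) (norm_nonneg _)
  calc ‖∑ Y', ∑ X', A X Y' * (A Y X' * c X' Y')‖
      ≤ ∑ Y', ∑ X', ‖A X Y'‖ * (a * ‖c X' Y'‖) :=
        (norm_sum_le _ _).trans (sum_le_sum fun Y' _ => (norm_sum_le _ _).trans (sum_le_sum fun X' _ => hterm Y' X'))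
    _ = ∑ Y', ‖A X Y'‖ * (a * ∑ X', ‖c X' Y'‖) := by
        refine sum_congr rfl fun Y' _ => ?_
        rw [← mul_sum, ← mul_sum]
    _ ≤ ∑ Y', ‖A X Y'‖ * (a * w) :=
        sum_le_sum fun Y' _ => mul_le_mul_of_nonneg_left (mul_le_mul_of_nonneg_left (hW Y') ha) (norm_nonneg _)
    _ ≤ α * (a * w) := by rw [← sum_mul]; exact mul_le_mul_of_nonneg_right hrow (mul_nonneg ha hw)
    _ = a * (α * w) := by ring

end Bound

end Literature.MathematicalPhysics.QuantumLattice

end
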